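import Literature.MathematicalPhysics.QuantumFieldTheory.Balaban1983to89.FlowStepRuns
import Summits.QuantumFields.BalabanUV.T4Continuum.Spine.NE4.AsymptoticContent

/-!
# Spine/NE4/EndpointFromNE4 — NE4 feeds the apex's β-binder B3: with the one-loop FLOOR and the corner bound, NE4 for the full β
# ⟹ `DagBinding.EndpointExistence` ([Balaban1987RG1] Thm 2's first sentence), with NO separate (AF-0r) input

Cell `pub-balaban-gaps` (YM blitz G2), seat `ne4` (unit `pub-balaban-gaps-ne4-g4`), record `HOME/ne/NE4.md` §5 census item (R31); companion of
`Spine/NE4/AsymptoticContent` (whose §2 proves NE4 ⟹ (AF-0r): `conv_of_scaleShiftRate`).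

WHY.  The print-faithful T⁴ apex `T4ContinuumYM4Torus.continuumYM4_torus_of_endpointExistence` has the β-binder
`hEnd : DagBinding.EndpointExistence D.C.toB12` (binder B3 of the cell's list, PLAN.md §A) next to the nine spine estimates (B5, among them
NE4).  The β sub-cell discharges `hEnd` from the LIMIT FORM of the printed one-loop split — `FlowStepRuns.endpointExistence_of_limitSplit`:
(AF-0r) `|β⁰_{k+1} − β⁰_∞| ≤ c₀θ^k` + (AF-1) `|β¹_{k+1}| ≤ C·g_k` + `C·γ₀ ≤ β⁰_∞` + the printed upper bound + continuity —, and (AF-0r) is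
the live crux GAPS G-an2-4 (NOT IN PRINT).  Since NE4 for the full β already CONTAINS (AF-0r) (`AsymptoticContent.conv_of_scaleShiftRate`),
the binder `hEnd` follows from the spine's NE4 + the corner bound + a one-loop FLOOR `b₀ ≤ β⁰_{k+1}` with `C·γ₀ ≤ b₀` (the floor passes to
the limit, `floor_le_binf`) + the printed-type upper bound + continuity: `endpointExistence_of_scaleShiftRate` (β-generic, any
forward-generated construction) and `endpointExistence_of_ne4OnData` (on Bałaban's data `D`, forward generation = the field `D.fwd`).
BOOKKEEPING CONSEQUENCE for the binder DAG (no status word moves): (AF-0r) is needed ONCE — it sits under B5's NE4 (NE4 ⟺ (AF-0r) ∧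
β¹-rate, `AsymptoticContent.scaleShiftRate_iff_split`) — and what B3 needs BEYOND the spine's NE4 is exactly the FLOOR (the sign ∕ (AF-0∞),
rows an5 ∕ CAP of the β sub-cell) and the corner bound (AF-1); none of these is printed, none is this seat's.

WHAT THIS FILE IS NOT.  Not an estimate: NE4, the floor, the corner bound, the upper bound and continuity are BINDERS; nothing of
Bałaban's is asserted; 0 definitions.  HONEST FRAMING: NE4 NOT IN PRINT ∕ NOT PROVED (DEPENDENT = (R)∘{NE5} + (AF-0r)); B3 NOT discharged
(0∕6 binders); spine 0∕9; one finite T⁴ — NOT continuum on ℝ⁴, NOT infinite volume, NOT a mass gap, NOT Clay.  0 sorry; axioms standard;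
imports `FlowStepRuns` + `Spine/NE4/AsymptoticContent`, modifies nothing.  Elementary, `[folklore]`.

References (locators only): [Balaban1987RG1] = T. Bałaban, CMP **109** (1987) 249–301: (0.20) p. 256, Thm 2 p. 259, (2.12)–(2.14) p. 268.
-/

namespace Summit.QuantumFields.BalabanUV.T4Continuum.Spine.NE4

open Literature.MathematicalPhysics.QuantumFieldTheory.Balaban1983to89
open Literature.MathematicalPhysics.QuantumFieldTheory.Balaban1983to89.FlowStep
open Literature.MathematicalPhysics.QuantumFieldTheory.Balaban1983to89.T4CouplingMatching (ScaleShiftRate)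
open Literature.MathematicalPhysics.QuantumFieldTheory.Balaban1983to89.T4Continuum
open Filter Topology

/-! ## §1 NE4 ⟹ `EndpointExistence` (binder B3), β-generic: `FlowStepRuns.endpointExistence_of_limitSplit` with its (AF-0r) input
discharged by `AsymptoticContent.conv_of_scaleShiftRate` -/

section Endpoint

variable {β : HBeta} (S : B12Beta.OneLoopSplit β) {C c γ θ : ℝ}

/-- [bookkeeping] `AsymptoticContent` §2's limit together with the convergence statement itself: under the corner bound and `θ < 1`,
`ScaleShiftRate c θ γ β` gives `β⁰_∞` with `β⁰_k → β⁰_∞` AND the geometric rate. [folklore] -/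
theorem tendsto_beta0_of_scaleShiftRate (hγ : 0 < γ) (hθ1 : θ < 1)
    (hC : ∀ k (p : Fin (k + 1) → ℝ), p ∈ Box γ k → |S.β1 k p| ≤ C * p (Fin.last k))
    (h : ScaleShiftRate c θ γ β) :
    ∃ binf : ℝ, Tendsto S.β0 atTop (𝓝 binf) ∧ ∀ k, |S.β0 k - binf| ≤ c / (1 - θ) * θ ^ k := by
  have hstep : ∀ n, dist (S.β0 n) (S.β0 (n + 1)) ≤ c * θ ^ n := fun n => by
    rw [Real.dist_eq, abs_sub_comm]
    exact abs_beta0_step_le_of_scaleShiftRate S hγ hC h n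
  obtain ⟨binf, hlim⟩ := cauchySeq_tendsto_of_complete (cauchySeq_of_le_geometric θ c hθ1 hstep)
  refine ⟨binf, hlim, fun k => ?_⟩
  have hk := dist_le_of_le_geometric_of_tendsto θ c hθ1 hstep hlim k
  rw [Real.dist_eq] at hk
  calc |S.β0 k - binf| ≤ c * θ ^ k / (1 - θ) := hk
    _ = c / (1 - θ) * θ ^ k := by ring

/-- [bookkeeping] A uniform one-loop FLOOR `b₀ ≤ β⁰_{k+1}` (shape (AF-0∞) of the β sub-cell, rows an5 / CAP; NOT PRINTED) passes
to the limit: `b₀ ≤ β⁰_∞`. [folklore] -/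
theorem floor_le_binf {binf b₀ : ℝ} (hlim : Tendsto S.β0 atTop (𝓝 binf)) (hfloor : ∀ k, b₀ ≤ S.β0 k) : b₀ ≤ binf :=
  ge_of_tendsto' hlim fun k => hfloor k

/-- **NE4 ⟹ ENDPOINT EXISTENCE (binder B3 of the T⁴ apex), no separate (AF-0r).**  For a forward-generated construction
(`DagBinding.ForwardGenerated C β`, [Balaban1987RG1] (0.20) p. 256) with the printed one-loop split `S`: NE4 for the full β
(`ScaleShiftRate c θ γ₀ β`, `0 ≤ θ < 1`), the corner bound (AF-1) `|β¹_{k+1}(p)| ≤ Cr·g_k`, a one-loop FLOOR `b₀ ≤ β⁰_{k+1}` with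
`Cr·γ₀ ≤ b₀`, the printed-type upper bound and continuity give `DagBinding.EndpointExistence C` — [Balaban1987RG1] Thm 2's first
sentence (a bare coupling for every small renormalised one, all scales).  The (AF-0r) input `hconv` of
`FlowStepRuns.endpointExistence_of_limitSplit` is DISCHARGED by `AsymptoticContent.conv_of_scaleShiftRate` (§2 there); what B3 still needs beyond the spine's NE4
is the floor (sign) and the corner bound — both NOT PRINTED, neither this seat's. [cite: Balaban1987RG1, Thm 2 p.259 and (0.20) p.256] -/
theorem endpointExistence_of_scaleShiftRate {C : B12.Construction} (hgen : DagBinding.ForwardGenerated C β)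
    {γ₀ Cr β' b₀ : ℝ} (hγ₀ : 0 < γ₀) (hθ0 : 0 ≤ θ) (hθ1 : θ < 1) (h : ScaleShiftRate c θ γ₀ β)
    (hAF1 : ∀ k (p : Fin (k + 1) → ℝ), p ∈ Box γ₀ k → |S.β1 k p| ≤ Cr * p (Fin.last k))
    (hCr : 0 ≤ Cr) (hfloor : ∀ k, b₀ ≤ S.β0 k) (hγ : Cr * γ₀ ≤ b₀)
    (hβ' : 0 ≤ β') (hcont : BetaContH γ₀ β) (hup : BetaUpperH β' γ₀ β) :
    DagBinding.EndpointExistence C := by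
  obtain ⟨binf, hlim, hconv⟩ := tendsto_beta0_of_scaleShiftRate S hγ₀ hθ1 hAF1 h
  have hc₀ : 0 ≤ c / (1 - θ) := div_nonneg (scaleShiftRate_const_nonneg h hγ₀) (by linarith)
  have hb : Cr * γ₀ ≤ binf := hγ.trans (floor_le_binf S hlim hfloor)
  exact FlowStepRuns.endpointExistence_of_limitSplit hgen S hγ₀ hθ0 hθ1 hc₀ hconv
    (fun k p hp => hAF1 k p (mem_box.mpr hp)) hCr hb hβ' hcont hup

end Endpoint

/-! ## §2 The same ON THE DATA -/

section EndpointData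

universe v

variable {F : T4Family} {G : Type v} [GaugeGroup G] [MeasurableSpace G] [HaarData G]

/-- [face] **ON THE DATA: NE4 ⟹ the apex's print-faithful β-binder.**  For Bałaban's data `D` (forward generation is the field
`D.fwd`) with a printed one-loop split `S` of `D.βfun`: `NE4OnData D c θ γ₀` + the corner bound + a one-loop floor with
`Cr·γ₀ ≤ b₀` + the printed-type upper bound + continuity ⟹ `DagBinding.EndpointExistence D.C.toB12` — the binder `hEnd` of
`T4ContinuumYM4Torus.continuumYM4_torus_of_endpointExistence`.  Bookkeeping consequence: in that apex's list, once the spine's NE4 is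
supplied the β sub-cell's (AF-0r) (GAPS G-an2-4) is not an independent input of `hEnd`. [folklore] -/
theorem endpointExistence_of_ne4OnData (D : FiniteEpsData F G) (S : B12Beta.OneLoopSplit D.βfun)
    {c θ γ₀ Cr β' b₀ : ℝ} (hγ₀ : 0 < γ₀) (hθ0 : 0 ≤ θ) (hθ1 : θ < 1) (h : NE4OnData D c θ γ₀)
    (hAF1 : ∀ k (p : Fin (k + 1) → ℝ), p ∈ Box γ₀ k → |S.β1 k p| ≤ Cr * p (Fin.last k))
    (hCr : 0 ≤ Cr) (hfloor : ∀ k, b₀ ≤ S.β0 k) (hγ : Cr * γ₀ ≤ b₀)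
    (hβ' : 0 ≤ β') (hcont : BetaContH γ₀ D.βfun) (hup : BetaUpperH β' γ₀ D.βfun) :
    DagBinding.EndpointExistence D.C.toB12 :=
  endpointExistence_of_scaleShiftRate S D.fwd hγ₀ hθ0 hθ1 h hAF1 hCr hfloor hγ hβ' hcont hup

end EndpointData

/-! ## §3 (v1.1) The floor is needed only EVENTUALLY — no small-k signs (matching `FlowStepRuns` §10's «NO hypothesis on the signs of
the finitely many small-k coefficients»): a TAIL floor `b₀ ≤ β⁰_{k+1}` for `k ≥ k₀` already gives `b₀ ≤ β⁰_∞` -/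

section Eventual

variable {β : HBeta} (S : B12Beta.OneLoopSplit β) {c θ : ℝ}

/-- [bookkeeping] An EVENTUAL one-loop floor `b₀ ≤ β⁰_{k+1}` (`k ≥ k₀`; shape (AF-0∞) — tail positivity, no small-k signs) passes to the
limit: `b₀ ≤ β⁰_∞`. [folklore] -/
theorem floor_le_binf_eventually {binf b₀ : ℝ} {k₀ : ℕ} (hlim : Tendsto S.β0 atTop (𝓝 binf))
    (hfloor : ∀ k, k₀ ≤ k → b₀ ≤ S.β0 k) : b₀ ≤ binf :=
  ge_of_tendsto hlim (Filter.eventually_atTop.mpr ⟨k₀, hfloor⟩)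

/-- **NE4 ⟹ ENDPOINT EXISTENCE with an EVENTUAL floor only.**  As `endpointExistence_of_scaleShiftRate`, but the one-loop floor is asked
only from some scale `k₀` on (`∀ k ≥ k₀, b₀ ≤ β⁰_{k+1}`, with `Cr·γ₀ ≤ b₀`): NE4 for the full β + the corner bound (AF-1) + this TAIL floor + the
printed-type upper bound + continuity ⟹ `DagBinding.EndpointExistence C` — NO hypothesis on the signs of `β⁰_1, …, β⁰_{k₀}` (they are absorbed
in the partial-sums constant `c/(1−θ)` exactly as in `FlowStepRuns.betaPartialSumsLowerH_of_limitSplit`). [cite: Balaban1987RG1, Thm 2 p.259 and (0.20) p.256] -/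
theorem endpointExistence_of_scaleShiftRate_eventualFloor {C : B12.Construction} (hgen : DagBinding.ForwardGenerated C β)
    {γ₀ Cr β' b₀ : ℝ} {k₀ : ℕ} (hγ₀ : 0 < γ₀) (hθ0 : 0 ≤ θ) (hθ1 : θ < 1) (h : ScaleShiftRate c θ γ₀ β)
    (hAF1 : ∀ k (p : Fin (k + 1) → ℝ), p ∈ Box γ₀ k → |S.β1 k p| ≤ Cr * p (Fin.last k))
    (hCr : 0 ≤ Cr) (hfloor : ∀ k, k₀ ≤ k → b₀ ≤ S.β0 k) (hγ : Cr * γ₀ ≤ b₀)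
    (hβ' : 0 ≤ β') (hcont : BetaContH γ₀ β) (hup : BetaUpperH β' γ₀ β) :
    DagBinding.EndpointExistence C := by
  obtain ⟨binf, hlim, hconv⟩ := tendsto_beta0_of_scaleShiftRate S hγ₀ hθ1 hAF1 h
  have hc₀ : 0 ≤ c / (1 - θ) := div_nonneg (scaleShiftRate_const_nonneg h hγ₀) (by linarith)
  have hb : Cr * γ₀ ≤ binf := hγ.trans (floor_le_binf_eventually S hlim hfloor)
  exact FlowStepRuns.endpointExistence_of_limitSplit hgen S hγ₀ hθ0 hθ1 hc₀ hconv
    (fun k p hp => hAF1 k p (mem_box.mpr hp)) hCr hb hβ' hcont hup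

end Eventual

section EventualData

universe w

variable {F : T4Family} {G : Type w} [GaugeGroup G] [MeasurableSpace G] [HaarData G]

/-- [face] ON THE DATA, eventual floor: `NE4OnData D c θ γ₀` + corner bound + TAIL floor (`k ≥ k₀`) with `Cr·γ₀ ≤ b₀` + upper bound +
continuity ⟹ `DagBinding.EndpointExistence D.C.toB12` (the apex's `hEnd`), no small-k signs. [folklore] -/
theorem endpointExistence_of_ne4OnData_eventualFloor (D : FiniteEpsData F G) (S : B12Beta.OneLoopSplit D.βfun)
    {c θ γ₀ Cr β' b₀ : ℝ} {k₀ : ℕ} (hγ₀ : 0 < γ₀) (hθ0 : 0 ≤ θ) (hθ1 : θ < 1) (h : NE4OnData D c θ γ₀)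
    (hAF1 : ∀ k (p : Fin (k + 1) → ℝ), p ∈ Box γ₀ k → |S.β1 k p| ≤ Cr * p (Fin.last k))
    (hCr : 0 ≤ Cr) (hfloor : ∀ k, k₀ ≤ k → b₀ ≤ S.β0 k) (hγ : Cr * γ₀ ≤ b₀)
    (hβ' : 0 ≤ β') (hcont : BetaContH γ₀ D.βfun) (hup : BetaUpperH β' γ₀ D.βfun) :
    DagBinding.EndpointExistence D.C.toB12 :=
  endpointExistence_of_scaleShiftRate_eventualFloor S D.fwd hγ₀ hθ0 hθ1 h hAF1 hCr hfloor hγ hβ' hcont hup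

end EventualData

end Summit.QuantumFields.BalabanUV.T4Continuum.Spine.NE4
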